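import Literature.IUT.LogVolume.LatticeAutBalls
import Mathlib.Analysis.Normed.Module.Ball.Pointwise
import Mathlib.Topology.Algebra.Module.FiniteDimension
import HarnessLib

/-!
# The subgroups stable under ALL lattice automorphisms are exactly the scalar multiples of the lattice
# (Weil, *Basic Number Theory*, Ch. II §2, Th. 1–2)

Classical `ℤ_p`-lattice algebra, sequel to `LatticeAutOrbits.lean` (transitivity of `Aut_{ℚ_p}(W : Λ)` on
primitive vectors) and `LatticeAutBalls.lean`.  For the lattice `Λ = L_b` of a basis `b` of a `ℚ_p`-vector
space `W` (tree `PadicModule.basisLattice`) and the group `Aut_{ℚ_p}(W : Λ)` of `ℚ_p`-linear automorphisms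
mapping `Λ` onto itself (tree `latticeAut`; the shape of Dupuy–Hilado's (Ind2) group
`Aut_{ℚ_p}(K_v : I_v)`, arXiv:2004.13228 §4.9):

* `coe_eq_smul_basisLattice_of_forall_image_subset` (algebraic form): an additive subgroup `M ⊆ c·Λ`
  containing a vector of content exactly `c` and mapped INTO itself by every lattice automorphism IS `c·Λ`
  (the orbit of a content-`c` vector additively generates `c·Λ`, tree `smul_basisLattice_subset_closure_iUnion_image`);
* for a `p`-adic FIELD `K` (a normed `ℚ_p`-algebra) and a basis `b` of `K/ℚ_p`: every COMPACT additive subgroup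
  `M ≠ 0` has a content (`exists_content_of_isCompact`: a vector of `M` with a coordinate of largest norm),
  whence the **classification** `forall_image_eq_iff_exists_zpow`: `M` is mapped onto itself by EVERY
  `φ ∈ Aut_{ℚ_p}(K : Λ)` **iff `M = p^k·Λ` for some `k ∈ ℤ`** — the `Aut_{ℚ_p}(K : Λ)`-stable lattices are
  the `ℚ_p^×`-multiples of `Λ` and nothing else;
* ball form (`K` ultrametric and proper): a ball `{‖y‖ ≤ r}`, `r > 0`, is fixed by all of `Aut_{ℚ_p}(K : Λ)` iff
  it is some `p^k·Λ` (`forall_image_closedBall_eq_iff`); two fixed balls have radii differing by a factor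
  `p^m`, `m ∈ ℤ` (`exists_norm_eq_zpow_mul_norm_of_forall_image_closedBall_eq`); so of two balls whose radii
  differ by a factor that is NOT an integral power of `p` at least one is moved
  (`exists_latticeAut_image_closedBall_ne_or`) — in particular, with a uniformizer `ϖ` of a field of absolute
  ramification index `e`, of `{‖y‖ ≤ ‖t‖}` and `{‖y‖ ≤ ‖t·ϖ^i‖}` with `e ∤ i`
  (`exists_latticeAut_image_closedBall_ne_or_of_not_dvd`), refining `LatticeAutBalls`'
  `exists_latticeAut_image_closedBall_ne` (`e ≥ 2 ⇒` SOME ball moves) to «at most one residue class of radii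
  `mod e` is fixed»; and when `Λ` is itself a ball `{‖y‖ ≤ ‖s‖}` the fixed balls are exactly those of radius
  `p^m·‖s‖` (`forall_image_closedBall_eq_iff_of_coe_eq_closedBall`).

[cite: WeilBNT1967, Ch. II §2, Th. 1–2] [cite: Cassels1997, Ch. I §2, Th. I Cor. 3] [cite: DupuyHilado2025, §4.9]
Consumer: the abc-iut cell's TEAM R «ismDH mover» thread (`Summits/ABC/IUTFork/Thm311RealIsmDHMover*.lean`),
which reads this at `Λ = log_p(𝒪_v^×)` (an adapted-basis lattice, `exists_adaptedBasis`) and the balls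
`t·𝒪_v`.  No side is taken on [IUTchIII] Cor. 3.12.  PROOF-ONLY file: no definitions, no named `Prop` facts.
-/

noncomputable section

open Set Metric
open scoped Pointwise

namespace Literature.IUT.LogVolume

namespace PadicModule

variable (p : ℕ) [Fact p.Prime]

/-! ## 1. Scalar multiples of a basis lattice -/

section Module

variable {W : Type*} [AddCommGroup W] [Module ℚ_[p] W]
variable {ι : Type*} [Fintype ι]

/-- Membership in `c·L_b` (`c ≠ 0`): all coordinates have norm `≤ ‖c‖`. [cite: WeilBNT1967, Ch. II §2, Th. 2] -/
theorem mem_smul_basisLattice_iff (b : Module.Basis ι ℚ_[p] W) {c : ℚ_[p]} (hc : c ≠ 0) (z : W) :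
    z ∈ c • (basisLattice p b : Set W) ↔ ∀ j, ‖b.repr z j‖ ≤ ‖c‖ := by
  constructor
  · rintro ⟨w, hw, rfl⟩ j
    rw [map_smul, Finsupp.smul_apply, smul_eq_mul, norm_mul]
    have h := (mem_basisLattice p b).1 hw j
    calc ‖c‖ * ‖b.repr w j‖ ≤ ‖c‖ * 1 := mul_le_mul_of_nonneg_left h (norm_nonneg _)
      _ = ‖c‖ := mul_one _
  · intro h
    refine ⟨c⁻¹ • z, ?_, ?_⟩
    · rw [SetLike.mem_coe, mem_basisLattice]
      intro j
      rw [map_smul, Finsupp.smul_apply, smul_eq_mul, norm_mul, norm_inv,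
        inv_mul_le_iff₀ (norm_pos_iff.2 hc), mul_one]
      exact h j
    · show c • (c⁻¹ • z) = z
      rw [smul_smul, mul_inv_cancel₀ hc, one_smul]

/-- Scalars of the same norm give the same multiple of the lattice (`ℤ_p^×` fixes `L_b`).
[cite: WeilBNT1967, Ch. II §2, Th. 2] -/
theorem smul_basisLattice_eq_of_norm_eq (b : Module.Basis ι ℚ_[p] W) {c c' : ℚ_[p]} (hc : c ≠ 0)
    (h : ‖c‖ = ‖c'‖) : c • (basisLattice p b : Set W) = c' • (basisLattice p b : Set W) := by
  have hc' : c' ≠ 0 := by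
    rw [← norm_pos_iff, ← h, norm_pos_iff]; exact hc
  ext z
  rw [mem_smul_basisLattice_iff p b hc, mem_smul_basisLattice_iff p b hc', h]

/-- Normal form: every multiple `c·L_b`, `c ≠ 0`, is `p^k·L_b` with `k = v_p(c)`.
[cite: WeilBNT1967, Ch. II §2, Th. 2] -/
theorem exists_smul_basisLattice_eq_zpow_smul (b : Module.Basis ι ℚ_[p] W) {c : ℚ_[p]} (hc : c ≠ 0) :
    ∃ k : ℤ, c • (basisLattice p b : Set W) = ((p : ℚ_[p]) ^ k) • (basisLattice p b : Set W) :=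
  ⟨c.valuation, smul_basisLattice_eq_of_norm_eq p b hc
    (by rw [Padic.norm_eq_zpow_neg_valuation hc, Padic.norm_p_zpow])⟩

/-- A lattice automorphism maps every `p^k·L_b` onto itself. [cite: WeilBNT1967, Ch. II §2, Th. 1] -/
theorem image_zpow_smul_basisLattice_of_mem (b : Module.Basis ι ℚ_[p] W) {φ : W ≃ₗ[ℚ_[p]] W}
    (hφ : φ ∈ latticeAut ℚ_[p] (basisLattice p b).toIntSubmodule) (k : ℤ) :
    φ '' (((p : ℚ_[p]) ^ k) • (basisLattice p b : Set W)) = ((p : ℚ_[p]) ^ k) • (basisLattice p b : Set W) :=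
  image_smul_basisLattice_of_mem p b hφ _

/-- **Stable subgroups, algebraic form.** An additive subgroup `M ⊆ c·L_b` that contains a vector `c·x₀` of
content exactly `c` (`x₀` primitive) and is mapped INTO itself by every lattice automorphism is `c·L_b`:
the orbit of `c·x₀` additively generates `c·L_b` (tree `smul_basisLattice_subset_closure_iUnion_image`).
[cite: WeilBNT1967, Ch. II §2, Th. 1] [cite: Cassels1997, Ch. I §2, Th. I Cor. 3] -/
theorem coe_eq_smul_basisLattice_of_forall_image_subset (b : Module.Basis ι ℚ_[p] W) (M : AddSubgroup W)
    {x₀ : W} (hx₀ : x₀ ∈ basisLattice p b) {i : ι} (hi : ‖b.repr x₀ i‖ = 1) {c : ℚ_[p]}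
    (hxM : c • x₀ ∈ M) (hM : (M : Set W) ⊆ c • (basisLattice p b : Set W))
    (hstab : ∀ φ ∈ latticeAut ℚ_[p] (basisLattice p b).toIntSubmodule,
      (φ : W ≃ₗ[ℚ_[p]] W) '' (M : Set W) ⊆ M) :
    (M : Set W) = c • (basisLattice p b : Set W) := by
  refine Subset.antisymm hM ((smul_basisLattice_subset_closure_iUnion_image p b hx₀ hi hxM).trans ?_)
  have h : AddSubgroup.closure (⋃ φ ∈ latticeAut ℚ_[p] (basisLattice p b).toIntSubmodule,
      (φ : W ≃ₗ[ℚ_[p]] W) '' (M : Set W)) ≤ M :=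
    (AddSubgroup.closure_le _).2 (iUnion₂_subset hstab)
  exact h

end Module

/-! ## 2. `p`-adic fields: compact subgroups have a content; the classification -/

section Field

variable {K : Type*} [NontriviallyNormedField K] [NormedAlgebra ℚ_[p] K]
variable {ι : Type*} [Fintype ι]

/-- Coordinates in a (finite) basis of `K/ℚ_p` are continuous (finite dimension over the complete field `ℚ_p`).
[cite: WeilBNT1967, Ch. I §2, Cor. 2 of Th. 3] -/
theorem continuous_repr_apply (b : Module.Basis ι ℚ_[p] K) (j : ι) : Continuous fun z : K => b.repr z j := by
  haveI : FiniteDimensional ℚ_[p] K := Module.Finite.of_basis b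
  exact (b.coord j).continuous_of_finiteDimensional

/-- **Content of a compact subgroup.** A compact additive subgroup `M ≠ 0` of `K` contains a vector `c·x₀`
(`x₀ ∈ L_b` primitive, `c ≠ 0`) with `M ⊆ c·L_b`: take a vector of `M` with a coordinate of largest norm
(compactness) and factor it as `c·x₀` (tree `exists_eq_smul_primitive`). [cite: WeilBNT1967, Ch. II §2, Th. 2] -/
theorem exists_content_of_isCompact [Nonempty ι] (b : Module.Basis ι ℚ_[p] K) (M : AddSubgroup K)
    (hMc : IsCompact (M : Set K)) (hM0 : ∃ y ∈ M, y ≠ 0) :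
    ∃ (c : ℚ_[p]) (x₀ : K) (i : ι), c ≠ 0 ∧ x₀ ∈ basisLattice p b ∧ ‖b.repr x₀ i‖ = 1 ∧ c • x₀ ∈ M ∧
      (M : Set K) ⊆ c • (basisLattice p b : Set K) := by
  classical
  -- the sup of the coordinate norms, a continuous function
  let f : K → ℝ := fun z => Finset.univ.sup' Finset.univ_nonempty fun j => ‖b.repr z j‖
  have hf : Continuous f :=
    Continuous.finset_sup'_apply Finset.univ_nonempty fun j _ => (continuous_repr_apply p b j).norm
  have hfle : ∀ z j, ‖b.repr z j‖ ≤ f z := fun z j =>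
    Finset.le_sup' (fun j => ‖b.repr z j‖) (Finset.mem_univ j)
  obtain ⟨y₁, hy₁M, hy₁0⟩ := hM0
  obtain ⟨y, hyM, hmax⟩ := hMc.exists_isMaxOn ⟨y₁, hy₁M⟩ hf.continuousOn
  -- the maximiser is nonzero
  have hy0 : y ≠ 0 := by
    rintro rfl
    have h0 : f 0 = 0 := by
      refine le_antisymm (Finset.sup'_le _ _ fun j _ => ?_) ?_
      · rw [map_zero, Finsupp.zero_apply, norm_zero]
      · exact (norm_nonneg _).trans (hfle 0 (Classical.arbitrary ι))
    apply hy₁0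
    refine b.repr.injective (Finsupp.ext fun j => ?_)
    have h1 : ‖b.repr y₁ j‖ ≤ 0 := ((hfle y₁ j).trans (hmax hy₁M)).trans_eq h0
    rw [map_zero, Finsupp.zero_apply]
    exact norm_le_zero_iff.1 h1
  obtain ⟨c, x₀, i, hc0, hx₀, hi, hyc, hle⟩ := exists_eq_smul_primitive p b hy0
  refine ⟨c, x₀, i, hc0, hx₀, hi, hyc ▸ hyM, fun z hz => ?_⟩
  rw [mem_smul_basisLattice_iff p b hc0]
  intro j
  exact (hfle z j).trans ((hmax hz).trans (Finset.sup'_le _ _ fun j _ => hle j))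

/-- **Every compact subgroup `M ≠ 0` mapped into itself by all of `Aut_{ℚ_p}(K : L_b)` is `p^k·L_b`.**
[cite: WeilBNT1967, Ch. II §2, Th. 1–2] [cite: Cassels1997, Ch. I §2, Th. I Cor. 3] -/
theorem exists_coe_eq_zpow_smul_of_forall_image_subset [Nonempty ι] (b : Module.Basis ι ℚ_[p] K)
    (M : AddSubgroup K) (hMc : IsCompact (M : Set K)) (hM0 : ∃ y ∈ M, y ≠ 0)
    (hstab : ∀ φ ∈ latticeAut ℚ_[p] (basisLattice p b).toIntSubmodule,
      (φ : K ≃ₗ[ℚ_[p]] K) '' (M : Set K) ⊆ M) :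
    ∃ k : ℤ, (M : Set K) = ((p : ℚ_[p]) ^ k) • (basisLattice p b : Set K) := by
  obtain ⟨c, x₀, i, hc0, hx₀, hi, hxM, hM⟩ := exists_content_of_isCompact p b M hMc hM0
  obtain ⟨k, hk⟩ := exists_smul_basisLattice_eq_zpow_smul p b hc0
  exact ⟨k, (coe_eq_smul_basisLattice_of_forall_image_subset p b M hx₀ hi hxM hM hstab).trans hk⟩

/-- **CLASSIFICATION OF THE STABLE LATTICES.** A compact additive subgroup `M ≠ 0` of `K` is mapped onto
itself by EVERY lattice automorphism of `L_b` iff `M = p^k·L_b` for some `k ∈ ℤ`: the `Aut_{ℚ_p}(K : Λ)`-stable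
lattices are exactly the `ℚ_p^×`-multiples of `Λ`. [cite: WeilBNT1967, Ch. II §2, Th. 1–2]
[cite: Cassels1997, Ch. I §2, Th. I Cor. 3] [cite: DupuyHilado2025, §4.9] -/
theorem forall_image_eq_iff_exists_zpow [Nonempty ι] (b : Module.Basis ι ℚ_[p] K) (M : AddSubgroup K)
    (hMc : IsCompact (M : Set K)) (hM0 : ∃ y ∈ M, y ≠ 0) :
    (∀ φ ∈ latticeAut ℚ_[p] (basisLattice p b).toIntSubmodule, (φ : K ≃ₗ[ℚ_[p]] K) '' (M : Set K) = M) ↔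
      ∃ k : ℤ, (M : Set K) = ((p : ℚ_[p]) ^ k) • (basisLattice p b : Set K) := by
  constructor
  · intro h
    exact exists_coe_eq_zpow_smul_of_forall_image_subset p b M hMc hM0 fun φ hφ => (h φ hφ).le
  · rintro ⟨k, hk⟩ φ hφ
    rw [hk]
    exact image_zpow_smul_basisLattice_of_mem p b hφ k

/-- Contrapositive: a compact subgroup `M ≠ 0` that is NO multiple `p^k·L_b` is MOVED by some lattice
automorphism. [cite: WeilBNT1967, Ch. II §2, Th. 1–2] [cite: DupuyHilado2025, §4.9] -/
theorem exists_latticeAut_image_ne [Nonempty ι] (b : Module.Basis ι ℚ_[p] K) (M : AddSubgroup K)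
    (hMc : IsCompact (M : Set K)) (hM0 : ∃ y ∈ M, y ≠ 0)
    (hne : ∀ k : ℤ, (M : Set K) ≠ ((p : ℚ_[p]) ^ k) • (basisLattice p b : Set K)) :
    ∃ φ ∈ latticeAut ℚ_[p] (basisLattice p b).toIntSubmodule, (φ : K ≃ₗ[ℚ_[p]] K) '' (M : Set K) ≠ M := by
  by_contra h
  push Not at h
  obtain ⟨k, hk⟩ := (forall_image_eq_iff_exists_zpow p b M hMc hM0).1 h
  exact hne k hk

/-! ## 3. Balls -/

omit [NormedAlgebra ℚ_[p] K] in
/-- Two closed balls about `0` with attained radii coincide iff the radii do (the sets `{‖y‖ ≤ r}` of a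
`p`-field). [cite: WeilBNT1967, Ch. II §1, Prop. 2] -/
theorem closedBall_norm_eq_closedBall_norm_iff (t u : K) :
    closedBall (0 : K) ‖t‖ = closedBall 0 ‖u‖ ↔ ‖t‖ = ‖u‖ := by
  refine ⟨fun h => le_antisymm ?_ ?_, fun h => by rw [h]⟩
  · have ht : t ∈ closedBall (0 : K) ‖u‖ := h ▸ mem_closedBall_zero_iff.2 le_rfl
    exact mem_closedBall_zero_iff.1 ht
  · have hu : u ∈ closedBall (0 : K) ‖t‖ := h.symm ▸ mem_closedBall_zero_iff.2 le_rfl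
    exact mem_closedBall_zero_iff.1 hu

/-- `p^k • {‖y‖ ≤ r} = {‖y‖ ≤ p^{-k}·r}` (`‖p‖ = p⁻¹`, `mod` is multiplicative). [cite: WeilBNT1967, Ch. II §1, Prop. 2] -/
theorem zpow_smul_closedBall (k : ℤ) (r : ℝ) :
    ((p : ℚ_[p]) ^ k) • closedBall (0 : K) r = closedBall 0 ((p : ℝ) ^ (-k) * r) := by
  have hq : ((p : ℚ_[p]) ^ k) ≠ 0 := zpow_ne_zero _ (Nat.cast_ne_zero.2 (Fact.out : p.Prime).ne_zero)
  rw [smul_closedBall' hq, smul_zero, Padic.norm_p_zpow]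

variable [IsUltrametricDist K]

/-- **Ball criterion.** In a proper ultrametric `p`-adic field, a closed ball `{‖y‖ ≤ r}` (`r > 0`) is mapped
onto itself by EVERY lattice automorphism of `L_b` iff it is `p^k·L_b` for some `k ∈ ℤ`.
[cite: WeilBNT1967, Ch. II §2, Th. 1–2] [cite: DupuyHilado2025, §4.9] -/
theorem forall_image_closedBall_eq_iff [ProperSpace K] [Nonempty ι] (b : Module.Basis ι ℚ_[p] K) {r : ℝ}
    (hr : 0 < r) :
    (∀ φ ∈ latticeAut ℚ_[p] (basisLattice p b).toIntSubmodule,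
        (φ : K ≃ₗ[ℚ_[p]] K) '' closedBall (0 : K) r = closedBall 0 r) ↔
      ∃ k : ℤ, closedBall (0 : K) r = ((p : ℚ_[p]) ^ k) • (basisLattice p b : Set K) := by
  obtain ⟨y, hy0, hyr⟩ := NormedField.exists_norm_lt K hr
  have hM : (((IsUltrametricDist.closedBall_openAddSubgroup K hr : OpenAddSubgroup K) : AddSubgroup K) :
      Set K) = closedBall 0 r := rfl
  have h := forall_image_eq_iff_exists_zpow p b
    ((IsUltrametricDist.closedBall_openAddSubgroup K hr : OpenAddSubgroup K) : AddSubgroup K)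
    (hM ▸ isCompact_closedBall (0 : K) r)
    ⟨y, by
      show y ∈ closedBall (0 : K) r
      exact mem_closedBall_zero_iff.2 hyr.le, norm_pos_iff.1 hy0⟩
  rw [hM] at h
  exact h

/-- **Two fixed balls have radii in ratio `p^ℤ`.** [cite: WeilBNT1967, Ch. II §2, Th. 2] -/
theorem exists_norm_eq_zpow_mul_norm_of_forall_image_closedBall_eq [ProperSpace K] [Nonempty ι]
    (b : Module.Basis ι ℚ_[p] K) {t t' : K} (ht : t ≠ 0) (ht' : t' ≠ 0)
    (h : ∀ φ ∈ latticeAut ℚ_[p] (basisLattice p b).toIntSubmodule,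
      (φ : K ≃ₗ[ℚ_[p]] K) '' closedBall (0 : K) ‖t‖ = closedBall 0 ‖t‖)
    (h' : ∀ φ ∈ latticeAut ℚ_[p] (basisLattice p b).toIntSubmodule,
      (φ : K ≃ₗ[ℚ_[p]] K) '' closedBall (0 : K) ‖t'‖ = closedBall 0 ‖t'‖) :
    ∃ m : ℤ, ‖t'‖ = (p : ℝ) ^ m * ‖t‖ := by
  have hp0 : ((p : ℚ_[p])) ≠ 0 := Nat.cast_ne_zero.2 (Fact.out : p.Prime).ne_zero
  obtain ⟨k, hk⟩ := (forall_image_closedBall_eq_iff p b (norm_pos_iff.2 ht)).1 h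
  obtain ⟨j, hj⟩ := (forall_image_closedBall_eq_iff p b (norm_pos_iff.2 ht')).1 h'
  -- `B(‖t'‖) = p^j Λ = p^{j-k} • p^k Λ = p^{j-k} • B(‖t‖) = B(p^{k-j} ‖t‖)`
  have e1 : closedBall (0 : K) ‖t'‖ = closedBall 0 (‖((p : ℚ_[p]) ^ (j - k)) • t‖) := by
    rw [hj, show ((p : ℚ_[p]) ^ j) = (p : ℚ_[p]) ^ (j - k) * (p : ℚ_[p]) ^ k by
      rw [← zpow_add₀ hp0, sub_add_cancel], mul_smul, ← hk, zpow_smul_closedBall, norm_smul,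
      Padic.norm_p_zpow]
  refine ⟨-(j - k), ?_⟩
  rw [(closedBall_norm_eq_closedBall_norm_iff t' _).1 e1, norm_smul, Padic.norm_p_zpow]

/-- **Of two balls whose radii ratio is not an integral power of `p`, at least one is moved** by some lattice
automorphism. [cite: WeilBNT1967, Ch. II §2, Th. 2] [cite: DupuyHilado2025, §4.9] -/
theorem exists_latticeAut_image_closedBall_ne_or [ProperSpace K] [Nonempty ι] (b : Module.Basis ι ℚ_[p] K)
    {t t' : K} (ht : t ≠ 0) (ht' : t' ≠ 0) (hratio : ∀ m : ℤ, ‖t'‖ ≠ (p : ℝ) ^ m * ‖t‖) :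
    (∃ φ ∈ latticeAut ℚ_[p] (basisLattice p b).toIntSubmodule,
        (φ : K ≃ₗ[ℚ_[p]] K) '' closedBall (0 : K) ‖t‖ ≠ closedBall 0 ‖t‖) ∨
      ∃ φ ∈ latticeAut ℚ_[p] (basisLattice p b).toIntSubmodule,
        (φ : K ≃ₗ[ℚ_[p]] K) '' closedBall (0 : K) ‖t'‖ ≠ closedBall 0 ‖t'‖ := by
  by_contra hc
  push Not at hc
  obtain ⟨m, hm⟩ := exists_norm_eq_zpow_mul_norm_of_forall_image_closedBall_eq p b ht ht' hc.1 hc.2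
  exact hratio m hm

/-- Arithmetic of the uniformizer: `‖ϖ^i‖ = p^m` forces `e ∣ i` (`‖ϖ‖^e = p⁻¹`).
[cite: WeilBNT1967, Ch. II §2, Th. 2] -/
theorem dvd_of_norm_zpow_eq_zpow [ProperSpace K]
    {ϖ : Kˣ} (hϖ : Literature.NumberTheory.GaloisRepresentations.Ultrametric.IsUniformizer ϖ) {i m : ℤ}
    (h : ‖(ϖ : K)‖ ^ i = (p : ℝ) ^ m) : (absRamificationIdx p K : ℤ) ∣ i := by
  have hp1 : (1 : ℝ) < p := by exact_mod_cast (Fact.out : p.Prime).one_lt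
  have he := norm_pow_absRamificationIdx p K hϖ
  -- raise `h` to the power `e`: `p^{-i} = p^{m e}`
  have h2 : (p : ℝ) ^ (-i) = (p : ℝ) ^ (m * (absRamificationIdx p K : ℤ)) := by
    calc (p : ℝ) ^ (-i) = ((p : ℝ)⁻¹) ^ i := by rw [zpow_neg, inv_zpow]
      _ = (‖(ϖ : K)‖ ^ (absRamificationIdx p K : ℤ)) ^ i := by rw [← he, zpow_natCast]
      _ = (‖(ϖ : K)‖ ^ i) ^ (absRamificationIdx p K : ℤ) := by rw [← zpow_mul, ← zpow_mul, mul_comm]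
      _ = ((p : ℝ) ^ m) ^ (absRamificationIdx p K : ℤ) := by rw [h]
      _ = (p : ℝ) ^ (m * (absRamificationIdx p K : ℤ)) := by rw [← zpow_mul]
  have h3 : -i = m * (absRamificationIdx p K : ℤ) :=
    zpow_right_injective₀ (by positivity) hp1.ne' h2
  exact ⟨-m, by linear_combination -h3⟩

/-- **With a uniformizer: of the balls `{‖y‖ ≤ ‖t‖}` and `{‖y‖ ≤ ‖t·ϖ^i‖}`, `e ∤ i`, at least one is moved**
by some lattice automorphism — for ANY basis lattice of a field of absolute ramification index `e`; so among
the balls `t·ϖ^i·𝒪`, `i mod e`, AT MOST ONE class is fixed by all of `Aut_{ℚ_p}(K : Λ)` (refines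
`exists_latticeAut_image_closedBall_ne`: `e ≥ 2 ⇒` some ball moves). [cite: WeilBNT1967, Ch. II §2, Th. 2]
[cite: DupuyHilado2025, §4.9] -/
theorem exists_latticeAut_image_closedBall_ne_or_of_not_dvd [ProperSpace K] [Nonempty ι]
    (b : Module.Basis ι ℚ_[p] K)
    {ϖ : Kˣ} (hϖ : Literature.NumberTheory.GaloisRepresentations.Ultrametric.IsUniformizer ϖ)
    {t : K} (ht : t ≠ 0) {i : ℤ} (hi : ¬ (absRamificationIdx p K : ℤ) ∣ i) :
    (∃ φ ∈ latticeAut ℚ_[p] (basisLattice p b).toIntSubmodule,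
        (φ : K ≃ₗ[ℚ_[p]] K) '' closedBall (0 : K) ‖t‖ ≠ closedBall 0 ‖t‖) ∨
      ∃ φ ∈ latticeAut ℚ_[p] (basisLattice p b).toIntSubmodule,
        (φ : K ≃ₗ[ℚ_[p]] K) '' closedBall (0 : K) ‖t * (ϖ : K) ^ i‖ ≠ closedBall 0 ‖t * (ϖ : K) ^ i‖ := by
  refine exists_latticeAut_image_closedBall_ne_or p b ht
    (mul_ne_zero ht (zpow_ne_zero _ ϖ.ne_zero)) fun m hm => hi ?_
  rw [norm_mul, norm_zpow, mul_comm] at hm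
  exact dvd_of_norm_zpow_eq_zpow p hϖ (mul_right_cancel₀ (norm_ne_zero_iff.2 ht) hm)

/-- **When the lattice is a ball** `L_b = {‖y‖ ≤ ‖s‖}` (e.g. `log_p(𝒪^×) = 𝔪` at a tame place): the ball
`{‖y‖ ≤ ‖t‖}` is fixed by every lattice automorphism iff `‖t‖ = p^m·‖s‖` for some `m ∈ ℤ`.
[cite: WeilBNT1967, Ch. II §2, Th. 2] [cite: DupuyHilado2025, §4.9] -/
theorem forall_image_closedBall_eq_iff_of_coe_eq_closedBall [ProperSpace K] [Nonempty ι]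
    (b : Module.Basis ι ℚ_[p] K) {s : K} (hΛ : (basisLattice p b : Set K) = closedBall 0 ‖s‖)
    {t : K} (ht : t ≠ 0) :
    (∀ φ ∈ latticeAut ℚ_[p] (basisLattice p b).toIntSubmodule,
        (φ : K ≃ₗ[ℚ_[p]] K) '' closedBall (0 : K) ‖t‖ = closedBall 0 ‖t‖) ↔
      ∃ m : ℤ, ‖t‖ = (p : ℝ) ^ m * ‖s‖ := by
  rw [forall_image_closedBall_eq_iff p b (norm_pos_iff.2 ht)]
  constructor
  · rintro ⟨k, hk⟩
    rw [hΛ, zpow_smul_closedBall, ← Padic.norm_p_zpow, ← norm_smul, closedBall_norm_eq_closedBall_norm_iff,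
      norm_smul, Padic.norm_p_zpow] at hk
    exact ⟨-k, hk⟩
  · rintro ⟨m, hm⟩
    refine ⟨-m, ?_⟩
    rw [hΛ, zpow_smul_closedBall, neg_neg, hm]

end Field

end PadicModule

end Literature.IUT.LogVolume

end
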